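import Literature.NumberTheory.Automorphic.BrandtGrossPoints
import Literature.NumberTheory.Automorphic.BrandtXi
import Literature.NumberTheory.EllipticCurves.HeegnerPoints
import Literature.NumberTheory.EllipticCurves.GlobalMinimalModel
import Literature.NumberTheory.EllipticCurves.Selmer
import Literature.NumberTheory.EllipticCurves.Sha
import Literature.NumberTheory.EllipticCurves.MordellWeil
import Literature.NumberTheory.EllipticCurves.BSDQuotientOverNumberField
import Literature.NumberTheory.EllipticCurves.ModularCurve
import Literature.NumberTheory.EllipticCurves.Tamagawa
import Literature.NumberTheory.DiophantineGeometry.TateAlgorithm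

/-!
# AN-45 — THE BOTTOM OF THE EDGE / MASS FORMULA (planner sketch, seat bsd-f1-sign2-an g31, MEMO-an §34)

Self-contained companion of the crux workfile `DefiniteMod2WaldspurgerAN43.lean` (V18, at the 200 kB cap; it cannot be
imported on the farm, so the four V12 edge definitions `IsEdgeCMIdeal`, `edgeValue`, `picStep`, `edgeThetaCoeff` are COPIED
VERBATIM below — same names, this namespace), attached to crux `RankOneAtTwoBigImageOddLocal` (stmt-BirchSwinnertonDyer-23715).

SETTING (MEMO-an §31–§33): `W/ℚ` of prime conductor `N ≡ 3 (mod 4)`, `k = ℚ(i)` (the prime `2` RAMIFIES, `𝔭² = (2)`), the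
definite quaternion algebra of discriminant `N` with Hecke eigenvector `φ` of `W` and `Φ = w·φ` (`edgeValue`), the based Gross point
`(ψ, I)` of conductor `1` (class number one: `Φ(I) = Φ(x_τ)` IS the Gross toric period, `Φ(x_τ)² ≐ L(W,1)·L(W^{(-1)},1)`,
Gross 1987 §11), and the level-`n` EDGE THETA ELEMENTS `θ_n = Σ_{j<2ⁿ⁻¹} Φ(gʲ J_n) [gʲ] ∈ ℤ[G_n]`, `G_n = Pic ℤ[2ⁿ i] ≅ ℤ/2ⁿ⁻¹`
(`edgeThetaCoeff`; `g` = the class of the norm-`5` prime, a generator).  Write `t_n := 𝟙(θ_n) = Σ_j Φ(gʲ J_n)` (the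
AUGMENTATION, independent of the base point), `a₂ = a₂(W)`, and for `a₂` odd let `α ∈ ℤ₂ˣ` be the unit root of `X² - a₂X + 2`.

§34 RESULTS (engine `MEMO-an-data/g31/ana/mass34.py`, `mass34b.py`, `charord.py` on the g28 T58 theta archive: 127 curves
`N ≤ 36187`, levels `n ≤ 8…11`; census `Cruxes/RankOneAtTwoBigImageOddLocal/census34.md`; this file v2):
* (Θ-aug) `EdgeAugmentationRecursion` — THE TWO BOTTOM IDENTITIES `2·t₁ = (a₂ - 1)·Φ(I)`, `t₂ = a₂ t₁ - Φ(I)` and the trace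
  recursion `t_{n+1} = a₂ t_n - 2 t_{n-1}` (`n ≥ 2`): 127/127 curves, 1028/1028 level rows (all reduction types).  PROVABLE (the
  `3 = 2+1` neighbours of the conductor-`1` vertex at the ramified prime: `𝔭·I ∼ I` and the two conductor-`2` lattices, one class).
* (Θ-ct) consequence for `a₂` odd: `t_n - (2/α) t_{n-1} = α^{n-1}(α - 1)·Φ(I)/2` (472/472 rows to 62 binary digits), i.e. the
  norm-compatible `θ_∞ ∈ ℤ₂⟦T⟧` has CONSTANT TERM `𝟙(θ_∞) = (1 - α⁻¹)·Φ(I)/2` — the one-factor anomalous `2`-adic multiplier at the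
  prime RAMIFIED in `k` (BD96 §2.10–2.11 define `L_p(χ)` only for `p ∤ disc k`); finite-level shadow `EdgeAugmentationValuation`:
  `v₂(t_n) = v₂Φ(I) - 1 + (3 - a₂)/2` for all `n ≥ 3` (42/42 rows on the 7 rank-`(0,0)` ordinary curves; `t_n ≡ 0` when `Φ(I) = 0`, 86/86).
* (Θ-mass) THE MASS FORMULA (`μ = 0`, Cornut–Vatsal): `v₂ 𝟙(θ_∞) = Σ_roots slope`, so for `r_an(W) = r_an(W^{(-1)}) = 0`:
  TOTAL ROOT MASS `= (3 - a₂)/2 + v₂Φ(I) - 1`; with the character zeros removed (`μ_m` := exact order of `θ_∞` at the conductor-`2^m`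
  characters, each of mass `1`) the NON-CHARACTER ("irregular") mass is `M_irr = (3-a₂)/2 + v₂Φ(I) - 1 - Σ_m μ_m ∈ ℕ`, and irregular
  zeros exist iff `M_irr > 0`: `EdgeRankZeroIrregularZeros`, 7/7 (16487: `2+1-2 = 1`, eight roots of slope `1/8`; 36187: `1+2-2 = 1`,
  two roots of slope `1/2`; 443c1, 4283a1, 5303a1, 10567, 19079: `0`, regular) — the mechanism behind the irregular ladders of §33.
* REGULAR DECOMPOSITION of all 53 ordinary curves: `λ = ρ + Σ_{m≥2} μ_m 2^{m-2} + λ_irr`, `v₂(leading coeff) = Σ_{m≥2} μ_m + M_irr`: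
  regular (`λ_irr = M_irr = 0`) 48/53; irregular 16487, 36187 (rank `(0,0)`, forced as above), 4159b1, 5503a1 (rank `(1,1)`,
  `M_irr = 1 = v₂δ_∞ - μ₂ - μ₃`), 4799c1 (rank `(2,0)`, `λ_irr = 2`, `M_irr = 3` read at the single level `n = 8`: a DEEP pair).
* (Θ-ρ) `EdgeTrivialOrderLaw`: exact order of `θ_∞` at `𝟙` `= max(r_an W, r_an W^{(-1)})` for ALL rank patterns `(0,0),(1,1),(0,2),
  (2,0),(1,3)`: 53/53 ordinary (V12 (Θ-BD₁/₂) had the 22 `(1,1)`/`(0,2)` curves); `a₂ = 0`: 36/36 (minimum over levels `n ≥ 4`).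
* (Θ-gen) `EdgeGenusOrderLowerBound`: the exact order `μ₂` of `θ_∞` at the GENUS character `χ₂` (`T = -2`, `↔ ℚ(ζ₈)/ℚ(i)`) satisfies
  `μ₂ ≥ max(r_an W^{(2)}, r_an W^{(-2)})` with the same parity: 53/53 ordinary, 36/36 for `a₂ = 0` on even levels.  EQUALITY holds in
  52/53 — the EXCEPTION 5443b1 (`a₂ = 1`, ranks `(0,2,1,1)`) has `μ₂ = 3` EXACTLY (levels `n = 5,6,7,8`, leading `(g+1)³`-coefficient
  of valuation `3 < n-1`, two independent engines): an EXCESS ZERO of the `2`-adic anticyclotomic theta at the genus character, the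
  first in the census (its §33 irregular ladder `+2` is this, not a non-character pair).  `a₂ = 0`: 4547a1 (`(2,0,1,1)`) reads `μ₂ = 3` at
  `n = 8` (uncertified: `±` trivial-zero factors inflate finite-level orders).
* (Θ-simple) `EdgeDeepZerosSimple`: every zero of `θ_∞` at a character of conductor `2^m ≥ 8` is SIMPLE: 25/25 ordinary instances
  (T62: `L(A/ℚ(√2), s)` of order exactly `2 = 2·1` for 19079, 36187); `a₂ = 0` parity-matched readings on the two top levels: 22 simple, 3 double (uncertified).
NOTHING HERE IS A THEOREM BEYOND PRINT; (Θ-aug)/(Θ-ct)/`EdgeAugmentationValuation` are theorem-SHAPE (Brandt-module algebra), and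
(Θ-mass) needs only `μ = 0` [cite: CornutVatsal2007, Thm 1.4] beyond them.  SOURCES: Bertolini–Darmon 1996 [doi:10.1007/s002220050105]
§2.10 (local multiplier `L_p(χ)`, `p ∤ disc K`), §2.11 (extra zeros); Longo–Pati 2018 [arXiv:1707.06019] (ramified `p`, multiplicative
reduction); Molina 2019 [doi:10.1090/tran/7646]; Gross 1987 [Gross1987Heights §11]; Cornut–Vatsal 2007; census31–34. -/

namespace Summit.BirchSwinnertonDyer.BirchSwinnertonDyer.Cruxes.RankOneAtTwoBigImageOddLocal.EdgeMass

open Literature.NumberTheory.Automorphic Literature.NumberTheory.Automorphic.Brandt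
open Literature.NumberTheory.EllipticCurves
open scoped NumberField nonZeroDivisors Pointwise Polynomial

variable {D : Type} [Ring D] [Algebra ℚ D] {k : Type} [Field k] [NumberField k]

/-- COPY of `DefiniteMod2Waldspurger.V12.IsEdgeCMIdeal` (AN43): level-`n` edge CM sub-ideal of the based Gross point `(ψ, I)` at
the ramified prime (`J ⊆ I` invertible right `O`-ideal of index `4ⁿ`, primitive, on the `I`-side of the edge `{I, ψ(𝔭)I}`). -/
def IsEdgeCMIdeal (O : Submodule ℤ D) (ψ : k →ₐ[ℚ] D) (I : Submodule ℤ D) (𝔭 : Ideal (𝓞 k)) (n : ℕ)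
    (J : Submodule ℤ D) : Prop :=
  J ∈ Brandt.rightIdeals O ∧ J ≤ I ∧ J.toAddSubgroup.relIndex I.toAddSubgroup = 4 ^ n ∧
    ¬ J ≤ Brandt.grossTranslate ψ (Ideal.span {(2 : 𝓞 k)}) I ∧ ¬ J ≤ Brandt.grossTranslate ψ 𝔭 I

/-- COPY of `V12.edgeValue` (AN43): `Φ(J) = w_{[J]}·φ([J])`. -/
noncomputable def edgeValue (O : Submodule ℤ D) (φ : Brandt.ClassSet O → ℤ) (J : Submodule ℤ D) : ℤ :=
  (Brandt.unitIndex (Brandt.leftOrder J) : ℤ) * Brandt.evalAtLattice φ J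

/-- COPY of `V12.picStep` (AN43): the CM translate by the class `g` of the norm-`5` prime `(1 + 2i₀)`, a generator of
`Pic ℤ[2ⁿ i] ≅ ℤ/2ⁿ⁻¹`. -/
def picStep (ψ : k →ₐ[ℚ] D) (i₀ : k) (n : ℕ) (J : Submodule ℤ D) : Submodule ℤ D :=
  AddSubgroup.toIntSubmodule
    (J.toAddSubgroup ⊓ ((J.toAddSubgroup.map (AddMonoidHom.mulLeft (5 : D))).comap
      (AddMonoidHom.mulLeft (ψ ((2 : k) ^ n * (1 - 2 * i₀))))))

/-- COPY of `V12.edgeThetaCoeff` (AN43): `c_j = Φ(gʲ J₀)`, the `j`-th coefficient of `θ_n(J₀) = Σ_{j<2ⁿ⁻¹} c_j [gʲ]`. -/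
noncomputable def edgeThetaCoeff (O : Submodule ℤ D) (φ : Brandt.ClassSet O → ℤ) (ψ : k →ₐ[ℚ] D) (i₀ : k)
    (n : ℕ) (J₀ : Submodule ℤ D) (j : ℕ) : ℤ :=
  edgeValue O φ ((picStep ψ i₀ n)^[j] J₀)

/-- The AUGMENTATION `t_n = 𝟙(θ_n) = Σ_{j<2ⁿ⁻¹} Φ(gʲ J₀)` — the sum of `Φ` over all `2ⁿ⁻¹` CM points of conductor `2ⁿ`
(independent of the base point `J₀`). -/
noncomputable def edgeThetaAug (O : Submodule ℤ D) (φ : Brandt.ClassSet O → ℤ) (ψ : k →ₐ[ℚ] D) (i₀ : k)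
    (n : ℕ) (J₀ : Submodule ℤ D) : ℤ :=
  ∑ j ∈ Finset.range (2 ^ (n - 1)), edgeThetaCoeff O φ ψ i₀ n J₀ j

/-- `θ_n` as an integer polynomial `P_n = Σ_{j<2ⁿ⁻¹} c_j Xʲ` (`X ↔ g`; `ℤ[G_n] = ℤ[X]/(X^{2ⁿ⁻¹} - 1)`). -/
noncomputable def edgeThetaPoly (O : Submodule ℤ D) (φ : Brandt.ClassSet O → ℤ) (ψ : k →ₐ[ℚ] D) (i₀ : k)
    (n : ℕ) (J₀ : Submodule ℤ D) : ℤ[X] :=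
  ∑ j ∈ Finset.range (2 ^ (n - 1)), Polynomial.C (edgeThetaCoeff O φ ψ i₀ n J₀ j) * Polynomial.X ^ j

/-- ORDER ALONG A CHARACTER IDEAL: `P ∈ (F^k) + (X^h - 1)` in `ℤ[X]`, i.e. the class of `P` in `ℤ[X]/(X^h - 1) = ℤ[G]` lies in the
`k`-th power of the ideal `(F)` (for `F ∣ X^h - 1` these powers are the character-ideal filtration; `(F) = I` for `F = X - 1`). -/
def PolyOrderGe (P F : ℤ[X]) (h k : ℕ) : Prop :=
  ∃ Q R : ℤ[X], P = F ^ k * Q + (Polynomial.X ^ h - 1) * R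

/-- The level-`m` CHARACTER FACTOR of `X^{2ⁿ⁻¹} - 1 = ∏_{m ≤ n} F_m`: `F_1 = X - 1` (trivial character, augmentation ideal),
`F_m = Φ_{2^{m-1}}(X) = X^{2^{m-2}} + 1` for `m ≥ 2` (`m = 2`: the genus character `g ↦ -1`; `m ≥ 3`: the `2^{m-2}` primitive
characters of conductor `2^m`, one Galois orbit).  A zero of `θ_∞` of order `μ` along `F_m` is `2^{m-2}` roots of slope `2^{2-m}`
(`m ≥ 2`): MASS `μ`. -/
noncomputable def edgeCharFactor (m : ℕ) : ℤ[X] :=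
  if m ≤ 1 then Polynomial.X - 1 else Polynomial.X ^ (2 ^ (m - 2)) + 1

/-- `θ_n(J₀)` has order EXACTLY `μ` along the level-`m` character ideal. -/
def EdgeCharOrderEq (O : Submodule ℤ D) (φ : Brandt.ClassSet O → ℤ) (ψ : k →ₐ[ℚ] D) (i₀ : k)
    (n : ℕ) (J₀ : Submodule ℤ D) (m μ : ℕ) : Prop :=
  PolyOrderGe (edgeThetaPoly O φ ψ i₀ n J₀) (edgeCharFactor m) (2 ^ (n - 1)) μ ∧
    ¬ PolyOrderGe (edgeThetaPoly O φ ψ i₀ n J₀) (edgeCharFactor m) (2 ^ (n - 1)) (μ + 1)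

/-- **(Θ-aug) `EdgeAugmentationRecursion` — the two BOTTOM identities and the trace recursion of the edge tower (support;
theorem-shape, -an g31 §34).**  `W` of prime conductor `N ≡ 3 (mod 4)`, any reduction type at `2`; `J m` a level-`m` edge CM ideal for
every `m ≥ 1`.  Then `2·t₁ = (a₂ - 1)·Φ(I)`, `t₂ = a₂·t₁ - Φ(I)`, and `t_{n+1} = a₂·t_n - 2·t_{n-1}` for `n ≥ 2`.  MECHANISM: the
adjacency (Brandt `B(2)`) relation `Σ_{v' ∼ v} Φ(v') = a₂ Φ(v)` on the Bruhat–Tits tree at the RAMIFIED prime: the conductor-`1` vertex `I`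
has the neighbour `ψ(𝔭)I ∼ I` (same class, `𝔭 = (1+i)` principal) and two conductor-`2` neighbours in ONE class (`[𝓞_k^× : ℤ[2i]^×] = 2`);
a conductor-`2ⁿ` vertex (`n ≥ 1`) has one neighbour of conductor `2^{n-1}` and two of conductor `2^{n+1}`.  DATA: 127/127 curves,
1028/1028 level rows (T58 `S` fields; C0/C1 of mass34.py).  WHY IT MIGHT FAIL: only through the typed set-up (`picStep` not a generator
of `Pic ℤ[2ⁿi]` for some `n` — T58-verified `n ≤ 11`; weight normalisation `Φ = w·φ` at `I`, `w(I) = 2`).  SOURCES: Gross 1987 §§3,11;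
Bertolini–Darmon 1996 §2.4–2.5 (compatibility of Gross points under norm, `p ∤ disc K`); T58. -/
def EdgeAugmentationRecursion : Prop :=
  ∀ (W : WeierstrassCurve ℚ) [W.IsElliptic] [W.IsGloballyMinimal] (N : ℕ),
    N.Prime → N % 4 = 3 → W.conductorNorm ℤ = N →
  ∀ (k : Type) [Field k] [NumberField k], IsImaginaryQuadratic k → NumberField.discr k = -4 →
  ∀ (i₀ : k), i₀ ^ 2 = -1 → ∀ (𝔭 : Ideal (𝓞 k)), 𝔭 ^ 2 = Ideal.span {(2 : 𝓞 k)} →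
  ∀ (S : Brandt.XiSetup 1 N) [Fintype (Brandt.ClassSet S.O)] (φ : Brandt.ClassSet S.O → ℤ) (ψ : k →ₐ[ℚ] S.D)
    (I : Submodule ℤ S.D), Brandt.IsGrossPoint S.O ψ I →
    φ ≠ 0 → Brandt.eigenLattice N (Brandt.matrix S.O) (fun p => W.frobeniusTrace p) = ℤ ∙ φ →
    ∀ J : ℕ → Submodule ℤ S.D, (∀ m ≥ 1, IsEdgeCMIdeal S.O ψ I 𝔭 m (J m)) →
      2 * edgeThetaAug S.O φ ψ i₀ 1 (J 1) = (W.frobeniusTrace 2 - 1) * edgeValue S.O φ I ∧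
      edgeThetaAug S.O φ ψ i₀ 2 (J 2) = W.frobeniusTrace 2 * edgeThetaAug S.O φ ψ i₀ 1 (J 1) - edgeValue S.O φ I ∧
      ∀ n ≥ 2, edgeThetaAug S.O φ ψ i₀ (n + 1) (J (n + 1))
        = W.frobeniusTrace 2 * edgeThetaAug S.O φ ψ i₀ n (J n) - 2 * edgeThetaAug S.O φ ψ i₀ (n - 1) (J (n - 1))

/-- **(Θ-ct) `EdgeAugmentationValuation` — the finite-level shadow of the CONSTANT TERM `𝟙(θ_∞) = (1 - α⁻¹)·Φ(I)/2` (support;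
theorem-shape corollary of (Θ-aug) by `t_n = C αⁿ + B βⁿ`, `C = (α-1)Φ(I)/(2(α-β))`, `v₂(B βⁿ) ≥ n + v₂Φ(I) - 1`, -an g31 §34).**
For `a₂` odd (then `a₂ = ±1`, ordinary and anomalous) and `Φ(I) ≠ 0` (`⟺ L(W,1)L(W^{(-1)},1) ≠ 0`, Gross): for every `n ≥ 3` and every
level-`n` base point, `v₂(t_n) = v₂(Φ(I)) - 1 + (3 - a₂)/2` — the anomaly exponent `v₂(1 - α⁻¹) = (3-a₂)/2 ∈ {1, 2}` plus the Gross-period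
exponent.  DATA: 42/42 level rows on the 7 rank-`(0,0)` ordinary curves (443c1, 4283a1, 5303a1, 10567, 16487, 19079, 36187:
`v₂ t_n = 2,2,2,2,3,3,3`); `Φ(I) = 0 ⟹ t_n = 0 ∀ n` (86/86 curves).  WHY IT MIGHT FAIL: it cannot once (Θ-aug) holds (pure `2`-adic
algebra); listed as the typed anchor of the mass formula.  SOURCES: as (Θ-aug); Mazur–Tate–Teitelbaum 1986 (the multiplier `1 - α⁻¹`). -/
def EdgeAugmentationValuation : Prop :=
  ∀ (W : WeierstrassCurve ℚ) [W.IsElliptic] [W.IsGloballyMinimal] (N : ℕ),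
    N.Prime → N % 4 = 3 → W.conductorNorm ℤ = N → Odd (W.frobeniusTrace 2) →
  ∀ (k : Type) [Field k] [NumberField k], IsImaginaryQuadratic k → NumberField.discr k = -4 →
  ∀ (i₀ : k), i₀ ^ 2 = -1 → ∀ (𝔭 : Ideal (𝓞 k)), 𝔭 ^ 2 = Ideal.span {(2 : 𝓞 k)} →
  ∀ (S : Brandt.XiSetup 1 N) [Fintype (Brandt.ClassSet S.O)] (φ : Brandt.ClassSet S.O → ℤ) (ψ : k →ₐ[ℚ] S.D)
    (I : Submodule ℤ S.D), Brandt.IsGrossPoint S.O ψ I →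
    φ ≠ 0 → Brandt.eigenLattice N (Brandt.matrix S.O) (fun p => W.frobeniusTrace p) = ℤ ∙ φ →
    edgeValue S.O φ I ≠ 0 →
    ∀ n ≥ 3, ∀ J₀ : Submodule ℤ S.D, IsEdgeCMIdeal S.O ψ I 𝔭 n J₀ →
      emultiplicity (2 : ℤ) (edgeThetaAug S.O φ ψ i₀ n J₀) + 1
        = emultiplicity (2 : ℤ) (edgeValue S.O φ I) + (((3 - W.frobeniusTrace 2) / 2).toNat : ℕ∞)

/-- **(Θ-mass) `EdgeRankZeroIrregularZeros` — ANOMALY + GROSS PERIOD FORCE NON-CHARACTER ZEROS (candidate, -an g31 §34; beyond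
print; theorem-shape modulo `μ = 0`).**  `a₂` odd, `r_an(W) = r_an(W^{(-1)}) = 0`.  MASS FORMULA: the norm-compatible `θ_∞ ∈ ℤ₂⟦T⟧`
has `μ = 0` (Cornut–Vatsal) and constant term `(1 - α⁻¹)Φ(I)/2` ((Θ-ct)), so by Weierstrass preparation the slopes of its `λ` roots add
up to `M := (3 - a₂)/2 + v₂Φ(I) - 1`; a zero of order `μ_m` at the conductor-`2^m` characters (`m ≥ 2`) is `μ_m·2^{m-2}` roots of total
mass `μ_m`.  Hence, at every large level `n` (orders `μ_m = μ m` read on `θ_n`, `λ` = the `𝔽₂[T]`-order `ℓ` of `θ̄_n`):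
`ℓ > Σ_{2 ≤ m ≤ n} μ_m 2^{m-2}` (irregular zeros exist) `⟺ M > Σ_{2 ≤ m ≤ n} μ_m` (spare mass).  DATA = BC5 WITNESS (census34 §A):
7/7 rank-`(0,0)` ordinary curves — 16487 (`a₂ = -1`, `Φ = 4`, `μ₂ = 2`: `M = 3 > 2`, `λ = 10 > 2`: eight roots of slope `1/8`),
36187 (`a₂ = 1`, `Φ = 8`, `μ₂ = μ₃ = 1`: `3 > 2`, `λ = 5 > 3`: two roots of slope `1/2`), and 443c1, 4283a1, 5303a1, 10567, 19079 with
`M = Σ μ_m`, `λ = Σ μ_m 2^{m-2}` (no irregular zeros).  WHY IT MIGHT FAIL: as typed only if the finite-level readings at the chosen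
`n ≥ n₁` do not yet see `θ_∞` (`λ ≥ 2^{n-2}`, or a leading coefficient vanishing mod `2^{n-1}` inflating some `μ_m`); mathematically it is
Weierstrass preparation + (Θ-ct) + `μ = 0`.  SOURCES: Cornut–Vatsal 2007 Thm 1.4; Bertolini–Darmon 1996 §2.11 (extra zeros, `p ∤ disc K`);
Pollack 2003 (cyclotomic analogue of root bookkeeping); census33/34. -/
def EdgeRankZeroIrregularZeros : Prop :=
  ∀ (W : WeierstrassCurve ℚ) [W.IsElliptic] [W.IsGloballyMinimal] (N : ℕ),
    N.Prime → N % 4 = 3 → W.conductorNorm ℤ = N → Odd (W.frobeniusTrace 2) → W.analyticRank = 0 →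
  ∀ (W₁ : WeierstrassCurve ℚ) [W₁.IsElliptic] [W₁.IsGloballyMinimal] (C₁ : WeierstrassCurve.VariableChange ℚ),
    C₁ • W₁ = W.quadraticTwist (-1 : ℚ) → W₁.analyticRank = 0 →
  ∀ (k : Type) [Field k] [NumberField k], IsImaginaryQuadratic k → NumberField.discr k = -4 →
  ∀ (i₀ : k), i₀ ^ 2 = -1 → ∀ (𝔭 : Ideal (𝓞 k)), 𝔭 ^ 2 = Ideal.span {(2 : 𝓞 k)} →
  ∀ (S : Brandt.XiSetup 1 N) [Fintype (Brandt.ClassSet S.O)] (φ : Brandt.ClassSet S.O → ℤ) (ψ : k →ₐ[ℚ] S.D)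
    (I : Submodule ℤ S.D), Brandt.IsGrossPoint S.O ψ I →
    φ ≠ 0 → Brandt.eigenLattice N (Brandt.matrix S.O) (fun p => W.frobeniusTrace p) = ℤ ∙ φ →
    ∃ n₁ : ℕ, ∀ n ≥ n₁, ∀ J₀ : Submodule ℤ S.D, IsEdgeCMIdeal S.O ψ I 𝔭 n J₀ →
    ∀ (μ : ℕ → ℕ), (∀ m, 2 ≤ m → m ≤ n → EdgeCharOrderEq S.O φ ψ i₀ n J₀ m (μ m)) →
    ∀ ℓ : ℕ, (∀ ℓ' < ℓ, Even (∑ j ∈ Finset.range (2 ^ (n - 1)), ((Nat.choose j ℓ' : ℕ) : ℤ) * edgeThetaCoeff S.O φ ψ i₀ n J₀ j)) →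
      Odd (∑ j ∈ Finset.range (2 ^ (n - 1)), ((Nat.choose j ℓ : ℕ) : ℤ) * edgeThetaCoeff S.O φ ψ i₀ n J₀ j) →
      ((∑ m ∈ Finset.Icc 2 n, μ m * 2 ^ (m - 2) < ℓ) ↔
        ((∑ m ∈ Finset.Icc 2 n, (μ m : ℕ∞)) + 1
          < emultiplicity (2 : ℤ) (edgeValue S.O φ I) + (((3 - W.frobeniusTrace 2) / 2).toNat : ℕ∞)))

/-- **(Θ-ρ) `EdgeTrivialOrderLaw` — Bertolini–Darmon order at `𝟙` EXACTLY `max(r_an W, r_an W^{(-1)})`, all rank patterns (candidate,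
-an g31 §34; extends V12 (Θ-BD₁)/(Θ-BD₂) from the 22 `(1,1)`/`(0,2)` curves).**  `a₂` odd: eventually `θ_n ∈ I^ρ ∖ I^{ρ+1}`,
`ρ = max(r_an W, r_an W^{(-1)})`.  DATA = BC5 WITNESS: 53/53 ordinary curves (patterns `(0,0)` ×7, `(1,1)` ×22, `(0,2)` ×15, `(2,0)` ×8,
`(1,3)` ×1: 4799a1 with `ρ = 3`), stable from `n = 5` except 3391a1, 5443b1, 9967 (from `n = 6`) and 4799c1 (at `n = 8`: leading
coefficients divisible by `2^{n-1}` at the smaller levels); `a₂ = 0`: 36/36 as the minimum over `n ≥ 4`.  WHY IT MIGHT FAIL: a degenerate `2`-adic anticyclotomic (derived)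
height at the anomalous ramified prime would give `ρ > max`; BD96 state the conjecture for `p ∤ 2N·disc K` only.  SOURCES: Bertolini–Darmon
1996 [doi:10.1007/s002220050105] Conj. 4.1; Bertolini–Darmon 1995 (derived heights); census34 §A. -/
def EdgeTrivialOrderLaw : Prop :=
  ∀ (W : WeierstrassCurve ℚ) [W.IsElliptic] [W.IsGloballyMinimal] (N : ℕ),
    N.Prime → N % 4 = 3 → W.conductorNorm ℤ = N → Odd (W.frobeniusTrace 2) →
  ∀ (W₁ : WeierstrassCurve ℚ) [W₁.IsElliptic] [W₁.IsGloballyMinimal] (C₁ : WeierstrassCurve.VariableChange ℚ),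
    C₁ • W₁ = W.quadraticTwist (-1 : ℚ) →
  ∀ (k : Type) [Field k] [NumberField k], IsImaginaryQuadratic k → NumberField.discr k = -4 →
  ∀ (i₀ : k), i₀ ^ 2 = -1 → ∀ (𝔭 : Ideal (𝓞 k)), 𝔭 ^ 2 = Ideal.span {(2 : 𝓞 k)} →
  ∀ (S : Brandt.XiSetup 1 N) [Fintype (Brandt.ClassSet S.O)] (φ : Brandt.ClassSet S.O → ℤ) (ψ : k →ₐ[ℚ] S.D)
    (I : Submodule ℤ S.D), Brandt.IsGrossPoint S.O ψ I →
    φ ≠ 0 → Brandt.eigenLattice N (Brandt.matrix S.O) (fun p => W.frobeniusTrace p) = ℤ ∙ φ →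
    ∃ n₁ : ℕ, ∀ n ≥ n₁, ∀ J₀ : Submodule ℤ S.D, IsEdgeCMIdeal S.O ψ I 𝔭 n J₀ →
      EdgeCharOrderEq S.O φ ψ i₀ n J₀ 1 (max W.analyticRank W₁.analyticRank)

/-- **(Θ-gen) `EdgeGenusOrderLowerBound` — the order at the GENUS CHARACTER is at least, and of the parity of,
`max(r_an W^{(2)}, r_an W^{(-2)})` (candidate, -an g31 §34; beyond print).**  `a₂` odd; `W₂, W₃` minimal models of the twists by `2, -2`
(`L(W/k, χ₂, s) = L(W₂, s)L(W₃, s)` for the genus character `χ₂` of `Pic ℤ[4i]`, `↔ ℚ(ζ₈)/ℚ(i)`): eventually the exact order `μ₂` of `θ_n`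
along `(g + 1)` satisfies `μ₂ ≥ max(r_an W₂, r_an W₃)` and `μ₂ ≡ max (mod 2)`.  DATA = BC5 WITNESS: 53/53 ordinary curves
(`max ∈ {0,1,2,3}`: 3391a1 has `r_an W₂ = 3`, `μ₂ = 3`); `a₂ = 0` on even levels 36/36.  THE EXACT LAW `μ₂ = max` holds in 52/53 and FAILS
for 5443b1 (`a₂ = 1`, `N ≡ 3 (8)`, ranks `(r, r₋₁, r₂, r₋₂) = (0,2,1,1)`, `c₂(W₋₁) = 4`, `c₂(W_{±2}) = 2`): `μ₂ = 3` exactly at `n = 5,6,7,8`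
(leading coefficient `8, 8, 56, 40 mod 16, 32, 64, 128`; engines charord.py and sign-twist + lead()), an EXCESS ZERO at `χ₂`; the six other
curves with the same rank pattern (139a1, 307b1, 1187b1, 1259b1, 3371b1, 3547b1) have `μ₂ = 1`.  WHY IT MIGHT FAIL: `μ₂ < max` would need a genus zero of `θ_∞` SHALLOWER than the rank
(against the Gross–Zagier–Kolyvagin direction); the parity clause is the functional equation `θ* = ±τ_N θ` at `χ₂` (sign `w(W₂) = w(W₃)`).
SOURCES: Bertolini–Darmon 1996 Conj. 4.1 (for `χ` of `p`-power conductor, `p ∤ disc K`); V17 `EdgeLadderLowerBound` (used `≥` as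
bookkeeping); census34 §A–§B. -/
def EdgeGenusOrderLowerBound : Prop :=
  ∀ (W : WeierstrassCurve ℚ) [W.IsElliptic] [W.IsGloballyMinimal] (N : ℕ),
    N.Prime → N % 4 = 3 → W.conductorNorm ℤ = N → Odd (W.frobeniusTrace 2) →
  ∀ (W₂ : WeierstrassCurve ℚ) [W₂.IsElliptic] [W₂.IsGloballyMinimal] (C₂ : WeierstrassCurve.VariableChange ℚ),
    C₂ • W₂ = W.quadraticTwist (2 : ℚ) →
  ∀ (W₃ : WeierstrassCurve ℚ) [W₃.IsElliptic] [W₃.IsGloballyMinimal] (C₃ : WeierstrassCurve.VariableChange ℚ),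
    C₃ • W₃ = W.quadraticTwist (-2 : ℚ) →
  ∀ (k : Type) [Field k] [NumberField k], IsImaginaryQuadratic k → NumberField.discr k = -4 →
  ∀ (i₀ : k), i₀ ^ 2 = -1 → ∀ (𝔭 : Ideal (𝓞 k)), 𝔭 ^ 2 = Ideal.span {(2 : 𝓞 k)} →
  ∀ (S : Brandt.XiSetup 1 N) [Fintype (Brandt.ClassSet S.O)] (φ : Brandt.ClassSet S.O → ℤ) (ψ : k →ₐ[ℚ] S.D)
    (I : Submodule ℤ S.D), Brandt.IsGrossPoint S.O ψ I →
    φ ≠ 0 → Brandt.eigenLattice N (Brandt.matrix S.O) (fun p => W.frobeniusTrace p) = ℤ ∙ φ →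
    ∃ n₁ : ℕ, ∀ n ≥ n₁, ∀ J₀ : Submodule ℤ S.D, IsEdgeCMIdeal S.O ψ I 𝔭 n J₀ →
      ∀ μ₂ : ℕ, EdgeCharOrderEq S.O φ ψ i₀ n J₀ 2 μ₂ →
        max W₂.analyticRank W₃.analyticRank ≤ μ₂ ∧ μ₂ % 2 = (max W₂.analyticRank W₃.analyticRank) % 2

/-- **(Θ-simple) `EdgeDeepZerosSimple` — zeros of `θ_∞` at characters of conductor `2^m ≥ 8` are SIMPLE (candidate, -an g31 §34;
beyond print).**  `a₂` odd: eventually, for every `3 ≤ m < n`, `θ_n ∉ (F_m)² + (X^{2ⁿ⁻¹} - 1)`, `F_m = X^{2^{m-2}} + 1` — i.e. when the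
conductor-`2^m` packet value `χ_m(θ_∞)` vanishes (`A_m = ⊤` in the §33 ladder; BSD side: `L(W/k ⊗ χ_m, s) = L(A_m, s)` of the
`2^{m-2}`-dimensional packet abelian variety vanishes to order exactly `2` per conjugate, T62 for 19079/36187 at `m = 3`) it vanishes to
order ONE.  DATA = BC5 WITNESS: 25/25 character zeros of conductor `≥ 8` on the 53 ordinary curves (`m = 3` ×22, `m = 4` ×3: 659a1
`m = 4`; 9967, 4159a1 `m = 3` and `4`); never order `2`.  (`a₂ = 0`, parity-matched characters on the two top levels: 22 simple and 3 double READINGS —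
finite-level orders on the signed branches are inflated by the trivial-zero factors and are not certified.)  WHY IT MIGHT FAIL: a packet abelian variety `A_m`
of analytic rank `≥ 4·[ℚ(χ_m):ℚ]/2` (rank `4` for a conductor-`8` packet) would give a double zero — nothing forbids it, it is rare.
SOURCES: Cornut–Vatsal 2007 (finitely many character zeros); census33 §E (T62), census34 §A. -/
def EdgeDeepZerosSimple : Prop :=
  ∀ (W : WeierstrassCurve ℚ) [W.IsElliptic] [W.IsGloballyMinimal] (N : ℕ),
    N.Prime → N % 4 = 3 → W.conductorNorm ℤ = N → Odd (W.frobeniusTrace 2) →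
  ∀ (k : Type) [Field k] [NumberField k], IsImaginaryQuadratic k → NumberField.discr k = -4 →
  ∀ (i₀ : k), i₀ ^ 2 = -1 → ∀ (𝔭 : Ideal (𝓞 k)), 𝔭 ^ 2 = Ideal.span {(2 : 𝓞 k)} →
  ∀ (S : Brandt.XiSetup 1 N) [Fintype (Brandt.ClassSet S.O)] (φ : Brandt.ClassSet S.O → ℤ) (ψ : k →ₐ[ℚ] S.D)
    (I : Submodule ℤ S.D), Brandt.IsGrossPoint S.O ψ I →
    φ ≠ 0 → Brandt.eigenLattice N (Brandt.matrix S.O) (fun p => W.frobeniusTrace p) = ℤ ∙ φ →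
    ∃ n₁ : ℕ, ∀ n ≥ n₁, ∀ J₀ : Submodule ℤ S.D, IsEdgeCMIdeal S.O ψ I 𝔭 n J₀ →
      ∀ m, 3 ≤ m → m < n →
        ¬ PolyOrderGe (edgeThetaPoly S.O φ ψ i₀ n J₀) (edgeCharFactor m) (2 ^ (n - 1)) 2

/-- Sanity: the character factors at `m = 1, 2, 3`. -/
theorem edgeCharFactor_one : edgeCharFactor 1 = Polynomial.X - 1 := by simp [edgeCharFactor]
theorem edgeCharFactor_two : edgeCharFactor 2 = Polynomial.X + 1 := by simp [edgeCharFactor]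
theorem edgeCharFactor_three : edgeCharFactor 3 = Polynomial.X ^ 2 + 1 := by simp [edgeCharFactor]

/-- Sanity: order `≥ 0` is free. -/
theorem polyOrderGe_zero (P F : ℤ[X]) (h : ℕ) : PolyOrderGe P F h 0 := ⟨P, 0, by simp⟩

end Summit.BirchSwinnertonDyer.BirchSwinnertonDyer.Cruxes.RankOneAtTwoBigImageOddLocal.EdgeMass
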